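import Summits.HodgeConjecture.HodgeConjecture.Theorems.MarkmanPartnerTransportIsometrySpannedThirdScalarAllRanks
import Summits.HodgeConjecture.HodgeConjecture.Theorems.MarkmanPartnerTransportK3Sq2TypeHodgeGraphClassesGeneral
import Literature.AlgebraicGeometry.HodgeTheory.AlgebraicClassesPullbackHolds
import HarnessLib

/-!
# Orphan levers, «KAPPA-MOD»: on a `K3^{[2]}`-type fourfold with real quadratic endomorphism field
# `E(X) = ℚ(θ)`, EVERY rational `(2,2)`-class is algebraic MODULO `ℚ·κ_θ`

Sub-problem `HodgeConjecture`, route MarkmanPartnerTransport, rung «ORPHAN-RM» (memo ROUTE-P1AJ; cell hodge-nonav,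
self-picked complement to T3B `OrphanSR.hodgeConjectureFor_of_kappaClass_generator`). For a marked smooth projective
`K3^{[2]}`-type fourfold `(X, φ, P, z)` with a rational, type-preserving, `q`-self-adjoint endomorphism `θ` of `H²`
such that every rational Hodge endomorphism of `H²` killing `N¹(X)` with `q`-transcendental image is `a + c·θ`
on `T(X)` (`a, c ∈ ℚ`), and every RATIONAL class `c ∈ H⁴(X(ℂ); ℂ)` of Hodge type `(2,2)`:

  `∃ r ∈ ℚ, c − r·κ_θ ∈ A²(X)`,  `κ_θ = Σᵢⱼ (G⁻¹)ᵢⱼ · φ⁻¹eᵢ ∪ θ(φ⁻¹eⱼ)`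

(`exists_rat_smul_kappaClass_sub_mem_algebraicClasses`), modulo {Verbitsky–Guan, O'Grady 2008}. So
`Hdg⁴(X)_ℚ ⊗ ℂ ⊆ A²(X) + ℂ·κ_θ`: the Hodge conjecture in degree `4` for such `X` is EXACTLY the algebraicity of the
one explicit class `κ_θ` (T3B is the converse direction).

Proof — the tree's `E = ℚ` engine (`…IsometrySpannedThirdScalarAllRanks`) run on `c₁ := c − (cc/2)·κ_θ`:
* `exists_cup3_kappaClass` — the cubic of the kappa class of ANY endomorphism `g`,
  `(κ_g ∪ y) ∪ w = (t·q(y,w) + q(gy,w) + q(gw,y))·P` (the identity of `exists_graphClass_of_kappaClass` without its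
  algebraicity binder; adapted from `…K3Sq2TypeHodgeGraphClassesGeneral`), so `F_{κ_θ} = t + 2θ` for self-adjoint `θ`;
* `map_mem_algebraicClasses_one_of_rational_hodge` — a rational type-preserving endomorphism of `H²` preserves
  `N¹(X)_ℂ` (Lefschetz `(1,1)`; `N¹` is spanned by rational classes);
* `k3HilbertForm_blockForm_of_transcendentalScalar` — the block form `q(G y, w) = a'·q(y,w) + (q(G y_N, w_N) −
  a'·q(y_N, w_N))` for ANY `q`-self-adjoint `G` with `π_T G (N¹) = 0` and `π_T G π_T = a'` on `T(X)`;
* with `F = F_c`: `π_T F` kills `N¹` (Claim A of the engine), `π_T F π_T = a + cc·θ` on `T` (the hypothesis), hence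
  `G := F − (cc·t/2) − cc·θ = F_{c₁}` has `π_T G π_T = a − cc·t/2 =: a'` on `T`; `exists_algebraicClass_of_symmetricForm`
  produces an algebraic `c'` with the cubic form of `c₁`, and `eq_of_cup3_eq` gives `c₁ = c'`.

CONDITIONAL on the named facts displayed; no definition, no sorry; credits nothing to the Hodge conjecture.
Prover seat hodge-nonav-20241-p1 (gen 13), `--supports stmt-HodgeConjecture-19653`.

References: S. Novario, Kyoto J. Math. 66 (2026) §4–6; K. O'Grady, Commun. Contemp. Math. 10 (2008) §2–3;
Yu. Zarhin, J. reine angew. Math. 341 (1983) Thm. 1.5.1; C. Voisin, *Hodge Theory I* §7.1, Thm. 11.30.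
-/

noncomputable section

set_option linter.dupNamespace false

open scoped Matrix
open Module CategoryTheory
open Literature.AlgebraicTopology.SingularHomology Literature.Geometry.Kaehler
open Literature.AlgebraicGeometry Literature.AlgebraicGeometry.Motives Literature.AlgebraicGeometry.HodgeTheory
open Literature.AlgebraicGeometry.Hyperkaehler Literature.AlgebraicGeometry.Surfaces
open Summit.HodgeConjecture.HodgeConjecture.Theorems.NikulinTwinTransport
open Summit.HodgeConjecture.HodgeConjecture.Theorems.MarkmanPartnerTransport.BBFPositivity

namespace Summit.HodgeConjecture.HodgeConjecture.Theorems.MarkmanPartnerTransport.PartnerLattice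

/-- `MarkedK3Sq[X, φ, P, z]`: VERBATIM the `let MarkedK3Sq := …` binder of the route declarations of
MarkmanPartnerTransport (clauses (m1)–(m6)). Local notation only. -/
local notation3 (prettyPrint := false) "MarkedK3Sq[" X ", " φ ", " P ", " z "]" =>
  (((IsIntegralClass P ∧ ∀ Q : complexBetti X (2 * 4), IsIntegralClass Q → ∃ n : ℤ, Q = n • P) ∧
    (∀ c : complexBetti X 2, IsIntegralClass c ↔ ∃ v : K3HilbertIndex → ℤ, φ c = fun i => (v i : ℂ)) ∧
    (∀ a : complexBetti X 2, cupPowTwo a 4 = ((3 : ℂ) * (k3HilbertForm 2 (φ a) (φ a)) ^ 2) • P) ∧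
    (IsOfHodgeType 4 X 2 2 0 (LinearEquiv.symm φ z) ∧
      ∀ τ : complexBetti X 2, IsOfHodgeType 4 X 2 2 0 τ → ∃ t : ℂ, τ = t • LinearEquiv.symm φ z) ∧
    (∀ c : complexBetti X 2, IsOfHodgeType 4 X 2 1 1 c ↔
      (k3HilbertForm 2 (φ c) z = 0 ∧ k3HilbertForm 2 (φ c) (star z) = 0)) ∧
    (k3HilbertForm 2 z z = 0 ∧ 0 < (k3HilbertForm 2 (star z) z).re)))

/-- `qC` = the complex Beauville–Bogomolov form on `ℂ²³` as a Mathlib bilinear form. Local notation only. -/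
local notation3 (prettyPrint := false) "qC" => Matrix.toBilin' (Matrix.map (k3HilbertGram 2) (Int.cast : ℤ → ℂ))

/-- `Cup3[c, y, w] = (c ∪ y) ∪ w ∈ H⁸` for `c ∈ H⁴`, `y, w ∈ H²`. Local notation only. -/
local notation3 (prettyPrint := false) "Cup3[" c ", " y ", " w "]" =>
  cupProduct (rfl : 2 * 3 + 2 = 2 * 4) (cupProduct (rfl : 2 * 2 + 2 = 2 * 3) c y) w

/-- `Kap[φ, g] = Σ_{ij} (G⁻¹)_{ij} · φ⁻¹eᵢ ∪ g(φ⁻¹eⱼ) ∈ H⁴(X(ℂ); ℂ)`, the kappa class of an endomorphism `g`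
of `H²(X(ℂ); ℂ)` (VERBATIM `…K3Sq2TypeHodgeGraphClassesGeneral`). Local notation only. -/
local notation3 (prettyPrint := false) "Kap[" φ ", " g "]" =>
  (∑ i : K3HilbertIndex, ∑ j : K3HilbertIndex,
    (((k3HilbertGram 2).map (Int.cast : ℤ → ℂ))⁻¹ i j) •
      cupProduct (rfl : 2 + 2 = 2 * 2) ((LinearEquiv.symm φ) (Pi.single i 1))
        (g ((LinearEquiv.symm φ) (Pi.single j 1))))

variable {X : SchemeOver ℂ} {φ : complexBetti X 2 ≃ₗ[ℂ] (K3HilbertIndex → ℂ)} {P : complexBetti X (2 * 4)}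
  {z : K3HilbertIndex → ℂ}

/-! ### The cubic form of a kappa class (no algebraicity needed) -/

/-- **The cubic of the kappa class of ANY endomorphism `g` of `H²(X(ℂ); ℂ)`**: there is `t ∈ ℂ` (`= Σ (G⁻¹)ᵢⱼ
q(eᵢ, g eⱼ)`) with `(κ_g ∪ y) ∪ w = (t·q(y,w) + q(gy,w) + q(gw,y))·P` — polarised Fujiki and the contraction
`Σ (G⁻¹)ᵢⱼ q(eᵢ,y) q(g eⱼ,w) = q(g y, w)`. The identity of `exists_graphClass_of_kappaClass`, freed of its
algebraicity binder. [cite: OGrady2008NumericalK3Square, §2.2 Remark 2.1] [cite: Markman2024, §1.1 Thm. 1.1] -/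
theorem exists_cup3_kappaClass (hM : MarkedK3Sq[X, φ, P, z]) (g : complexBetti X 2 →ₗ[ℂ] complexBetti X 2) :
    ∃ t : ℂ, ∀ y w : complexBetti X 2,
      Cup3[Kap[φ, g], y, w] = (t * k3HilbertForm 2 (φ y) (φ w) + k3HilbertForm 2 (φ (g y)) (φ w) +
        k3HilbertForm 2 (φ (g w)) (φ y)) • P := by
  -- adapted from `exists_graphClass_of_kappaClass` (…K3Sq2TypeHodgeGraphClassesGeneral), same computation
  classical
  have hmk : IsMarkedK3Hilb 2 X φ P := isMarkedK3Hilb_of_marked hM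
  refine ⟨∑ i, ∑ j, ((k3HilbertGram 2).map (Int.cast : ℤ → ℂ))⁻¹ i j *
    k3HilbertForm 2 (Pi.single i 1) (φ (g ((LinearEquiv.symm φ) (Pi.single j 1)))), fun y w => ?_⟩
  have hL2 : ∀ (u : ℂ) (A : complexBetti X (2 * 2)), Cup3[u • A, y, w] = u • Cup3[A, y, w] := by
    intro u A; simp only [map_smul, LinearMap.smul_apply]
  have hL3 : ∀ A : K3HilbertIndex → complexBetti X (2 * 2), Cup3[∑ i, A i, y, w] = ∑ i, Cup3[A i, y, w] := by
    intro A; simp only [map_sum, LinearMap.sum_apply]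
  have hvv : ∀ i j, Cup3[cupProduct (rfl : 2 + 2 = 2 * 2) ((LinearEquiv.symm φ) (Pi.single i 1))
      (g ((LinearEquiv.symm φ) (Pi.single j 1))), y, w] =
      (k3HilbertForm 2 (Pi.single i 1) (φ (g ((LinearEquiv.symm φ) (Pi.single j 1)))) *
            k3HilbertForm 2 (φ y) (φ w) +
          k3HilbertForm 2 (Pi.single i 1) (φ y) *
            k3HilbertForm 2 (φ (g ((LinearEquiv.symm φ) (Pi.single j 1)))) (φ w) +
        k3HilbertForm 2 (Pi.single i 1) (φ w) *
          k3HilbertForm 2 (φ (g ((LinearEquiv.symm φ) (Pi.single j 1)))) (φ y)) • P := by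
    intro i j
    have h := (cupFour_def _ _ _ _).symm.trans (cupFour_eq_of_isMarkedK3Hilb hmk
      ((LinearEquiv.symm φ) (Pi.single i 1)) (g ((LinearEquiv.symm φ) (Pi.single j 1))) y w)
    rw [LinearEquiv.apply_symm_apply] at h
    exact h
  set qXform : LinearMap.BilinForm ℂ (complexBetti X 2) :=
    (Matrix.toBilin' (Matrix.map (k3HilbertGram 2) (Int.cast : ℤ → ℂ))).compl₁₂
      (φ : complexBetti X 2 →ₗ[ℂ] (K3HilbertIndex → ℂ)) (φ : complexBetti X 2 →ₗ[ℂ] (K3HilbertIndex → ℂ))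
    with hqXform
  have hqXapp : ∀ y w, qXform y w = k3HilbertForm 2 (φ y) (φ w) := fun y w => by
    rw [hqXform, LinearMap.compl₁₂_apply, qC_apply]; rfl
  have hlin : ∀ y w : complexBetti X 2,
      ∑ j, (φ y) j * k3HilbertForm 2 (φ (g ((LinearEquiv.symm φ) (Pi.single j 1)))) (φ w) =
        k3HilbertForm 2 (φ (g y)) (φ w) := by
    intro y w
    set M : (K3HilbertIndex → ℂ) →ₗ[ℂ] complexBetti X 2 →ₗ[ℂ] ℂ :=
      qXform ∘ₗ g ∘ₗ (φ.symm : (K3HilbertIndex → ℂ) →ₗ[ℂ] complexBetti X 2) with hMdef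
    have hMv : ∀ v, M v w = k3HilbertForm 2 (φ (g ((LinearEquiv.symm φ) v))) (φ w) := fun v => by
      rw [hMdef, LinearMap.comp_apply, LinearMap.comp_apply, hqXapp]
      rfl
    have hexp : (φ y : K3HilbertIndex → ℂ) = ∑ j, (φ y) j • (Pi.single j 1 : K3HilbertIndex → ℂ) := by
      ext i
      simp [Finset.sum_apply, Pi.single_apply]
    calc ∑ j, (φ y) j * k3HilbertForm 2 (φ (g ((LinearEquiv.symm φ) (Pi.single j 1)))) (φ w)
        = ∑ j, (φ y) j * M (Pi.single j 1) w := Finset.sum_congr rfl fun j _ => by rw [hMv]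
      _ = M (∑ j, (φ y) j • (Pi.single j 1 : K3HilbertIndex → ℂ)) w := by
          rw [map_sum, LinearMap.sum_apply]
          exact Finset.sum_congr rfl fun j _ => by rw [map_smul, LinearMap.smul_apply, smul_eq_mul]
      _ = k3HilbertForm 2 (φ (g y)) (φ w) := by rw [← hexp, hMv, LinearEquiv.symm_apply_apply]
  have hS : ∀ y w : complexBetti X 2, ∑ i, ∑ j, ((k3HilbertGram 2).map (Int.cast : ℤ → ℂ))⁻¹ i j *
      k3HilbertForm 2 (Pi.single i 1) (φ y) *
        k3HilbertForm 2 (φ (g ((LinearEquiv.symm φ) (Pi.single j 1)))) (φ w) =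
      k3HilbertForm 2 (φ (g y)) (φ w) := by
    intro y w
    rw [Finset.sum_comm, ← hlin y w]
    refine Finset.sum_congr rfl fun j _ => ?_
    rw [← sum_gramInv_k3HilbertForm_single_eq (φ y) j, Finset.sum_mul]
  rw [hL3]
  simp_rw [hL3, hL2, hvv, smul_smul, ← Finset.sum_smul]
  congr 1
  simp only [mul_add, Finset.sum_add_distrib]
  rw [← hS y w, ← hS w y, Finset.sum_mul]
  congr 1
  · congr 1
    · refine Finset.sum_congr rfl fun i _ => ?_
      rw [Finset.sum_mul]
      exact Finset.sum_congr rfl fun j _ => by ring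
    · exact Finset.sum_congr rfl fun i _ => Finset.sum_congr rfl fun j _ => by ring
  · exact Finset.sum_congr rfl fun i _ => Finset.sum_congr rfl fun j _ => by ring

/-! ### Rational Hodge endomorphisms preserve `N¹(X)` -/

/-- **A rational, `(1,1)`-type-preserving endomorphism of `H²(X(ℂ); ℂ)` maps `N¹(X)_ℂ` into itself**: `N¹` is
spanned by rational algebraic classes (`supportedClasses_eq_span_isRationalClass`), which are of type `(1,1)`,
and a rational `(1,1)`-class is algebraic (Lefschetz, `lefschetzOneOne_rational_holds`). Any dimension `n`.
[cite: VoisinHodgeI2002, Thm. 11.30 and Prop. 11.20] -/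
theorem map_mem_algebraicClasses_one_of_rational_hodge {n : ℕ} (hX : IsSmoothProjective n X)
    (e : complexBetti X 2 →ₗ[ℂ] complexBetti X 2) (he_rat : ∀ y, IsRationalClass y → IsRationalClass (e y))
    (he_typ : ∀ y, IsOfHodgeType n X 2 1 1 y → IsOfHodgeType n X 2 1 1 (e y)) :
    ∀ d ∈ algebraicClasses X 1, e d ∈ algebraicClasses X 1 := by
  have hspan := supportedClasses_eq_span_isRationalClass hX 2 1
  change algebraicClasses X 1 = Submodule.span ℂ
    {c : complexBetti X 2 | IsRationalClass c ∧ c ∈ algebraicClasses X 1} at hspan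
  intro d hd
  rw [hspan] at hd
  have hle : Submodule.span ℂ {c : complexBetti X 2 | IsRationalClass c ∧ c ∈ algebraicClasses X 1} ≤
      (algebraicClasses X 1).comap e := by
    refine Submodule.span_le.2 ?_
    rintro c ⟨hcrat, hcalg⟩
    exact lefschetzOneOne_rational_holds hX _ (he_rat _ hcrat)
      (he_typ _ (isOfHodgeType_of_mem_algebraicClasses_of_isSmoothProjective hX 1 hcalg))
  exact hle hd

/-! ### The block form of a self-adjoint endomorphism which is a scalar on `T(X)` -/

/-- **Block form.** For a marked `X`, a `q`-self-adjoint endomorphism `G` of `H²`, and a transcendental projector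
`π_T` (zero on `N¹`, identity on `T`, values in `T`, `y − π_T y ∈ N¹`, self-adjoint) with `π_T G (N¹) = 0` and
`π_T G = a'` on `T(X)`: `q(G y, w) = a'·q(y,w) + (q(G y_N, w_N) − a'·q(y_N, w_N))`, `y_N = y − π_T y` (pure
`q`-algebra in a marking `φ`; the computation of `exists_transcendentalScalar_of_classEndomorphism` with the scalar
hypothesis abstracted).
[cite: Zarhin1983HodgeGroupsK3, Thm. 1.5.1] [cite: Novario2026HodgeClassesHilbertSquares, Thm. 6.2] -/
theorem k3HilbertForm_blockForm_of_transcendentalScalar (φ : complexBetti X 2 ≃ₗ[ℂ] (K3HilbertIndex → ℂ))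
    {G πT : complexBetti X 2 →ₗ[ℂ] complexBetti X 2} {a' : ℂ}
    (hGadj : ∀ y w, k3HilbertForm 2 (φ (G y)) (φ w) = k3HilbertForm 2 (φ y) (φ (G w)))
    (hT2 : ∀ y : complexBetti X 2, (∀ d ∈ algebraicClasses X 1, k3HilbertForm 2 (φ y) (φ d) = 0) → πT y = y)
    (hT3 : ∀ y : complexBetti X 2, ∀ d ∈ algebraicClasses X 1, k3HilbertForm 2 (φ (πT y)) (φ d) = 0)
    (hT4 : ∀ y : complexBetti X 2, y - πT y ∈ algebraicClasses X 1)
    (hT6 : ∀ y w, k3HilbertForm 2 (φ (πT y)) (φ w) = k3HilbertForm 2 (φ y) (φ (πT w)))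
    (hA : ∀ d ∈ algebraicClasses X 1, πT (G d) = 0)
    (hC : ∀ y : complexBetti X 2, (∀ d ∈ algebraicClasses X 1, k3HilbertForm 2 (φ y) (φ d) = 0) →
      πT (G y) = a' • y)
    (y w : complexBetti X 2) :
    k3HilbertForm 2 (φ (G y)) (φ w) =
      a' * k3HilbertForm 2 (φ y) (φ w) +
        (k3HilbertForm 2 (φ (G (y - πT y))) (φ (w - πT w)) - a' * k3HilbertForm 2 (φ (y - πT y)) (φ (w - πT w))) := by
  -- adapted from `exists_transcendentalScalar_of_classEndomorphism` (…IsometrySpannedThirdScalarAllRanks)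
  have hNT : ∀ n ∈ algebraicClasses X 1, ∀ w, k3HilbertForm 2 (φ n) (φ (πT w)) = 0 := fun n hn w => by
    rw [k3HilbertForm_comm]; exact hT3 w n hn
  have hTT : k3HilbertForm 2 (φ (G (πT y))) (φ w) = a' * k3HilbertForm 2 (φ (πT y)) (φ w) := by
    have hw : w = (w - πT w) + πT w := by abel
    have h1 : k3HilbertForm 2 (φ (G (πT y))) (φ (w - πT w)) = 0 := by
      rw [hGadj, k3HilbertForm_comm, ← hT6, hA _ (hT4 w), map_zero, k3HilbertForm_comm, k3HilbertForm_apply]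
      simp
    have h2 : k3HilbertForm 2 (φ (G (πT y))) (φ (πT w)) = a' * k3HilbertForm 2 (φ (πT y)) (φ (πT w)) := by
      have e1 : πT (G (πT y)) = a' • πT y := hC (πT y) (hT3 y)
      rw [← hT6, e1, map_smul, k3HilbertForm_smul_left, hT6 y w, hT6 y (πT w), hT2 (πT w) (hT3 w)]
    have h3 : k3HilbertForm 2 (φ (πT y)) (φ (w - πT w)) = 0 := by
      rw [k3HilbertForm_comm]; exact hNT _ (hT4 w) _
    conv_lhs => rw [hw, map_add, k3HilbertForm_add_right, h1, zero_add, h2]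
    conv_rhs => rw [hw, map_add, k3HilbertForm_add_right, h3, zero_add]
  have hNT' : k3HilbertForm 2 (φ (G (y - πT y))) (φ (πT w)) = 0 := by
    rw [← hT6, hA _ (hT4 y), map_zero, k3HilbertForm_apply]; simp
  have hy : y = (y - πT y) + πT y := by abel
  have hw : w = (w - πT w) + πT w := by abel
  have lhs : k3HilbertForm 2 (φ (G y)) (φ w) =
      k3HilbertForm 2 (φ (G (y - πT y))) (φ (w - πT w)) + a' * k3HilbertForm 2 (φ (πT y)) (φ w) := by
    conv_lhs => rw [hy, map_add, map_add, k3HilbertForm_add_left, hTT]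
    congr 1
    conv_lhs => rw [hw, map_add, k3HilbertForm_add_right, hNT', add_zero]
  have qsplit : k3HilbertForm 2 (φ y) (φ w) =
      k3HilbertForm 2 (φ (y - πT y)) (φ (w - πT w)) + k3HilbertForm 2 (φ (πT y)) (φ w) := by
    conv_lhs => rw [hy, map_add, k3HilbertForm_add_left]
    congr 1
    conv_lhs => rw [hw, map_add, k3HilbertForm_add_right, hNT _ (hT4 y) w, add_zero]
  rw [lhs, qsplit]; ring

/-! ### KAPPA-MOD -/

/-- **(KAPPA-MOD) Every rational `(2,2)`-class is algebraic modulo `ℚ·κ_θ`** on a marked smooth projective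
`K3^{[2]}`-type fourfold whose rational Hodge endomorphisms of `H²` killing `N¹(X)` with `q`-transcendental image
are `a + c·θ` on `T(X)` for ONE rational, type-preserving, `q`-self-adjoint `θ` (`E(X) = ℚ(θ)` real quadratic;
any Picard rank, partnered or orphan): `∃ r ∈ ℚ, c − r·κ_θ ∈ A²(X)`. With `F = F_c`, `π_T F π_T = a + cc·θ` on
`T` and `F_{κ_θ} = t + 2θ`, the class `c − (cc/2)κ_θ` has endomorphism a scalar `a − cc·t/2` on `T`, so it is
algebraic by the `E = ℚ` engine (`exists_algebraicClass_of_symmetricForm` + `eq_of_cup3_eq`). Modulo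
{Verbitsky–Guan, O'Grady 2008}; the multiplicativity of algebraic classes is the tree theorem
`Voisin2003_cupProduct_algebraicClasses_holds'`. [cite: Novario2026HodgeClassesHilbertSquares, Thm. 6.2 and §4]
[cite: OGrady2008NumericalK3Square, §3] [cite: Zarhin1983HodgeGroupsK3, Thm. 1.5.1] -/
theorem exists_rat_smul_kappaClass_sub_mem_algebraicClasses
    (hV : VerbitskyGuan_cohomology_K3HilbertSquareType) (hO : OGrady2008_dualBBFClass_algebraic)
    (hX : IsSmoothProjective 4 X) (hK : IsOfK3HilbertSquareType X) (hM : MarkedK3Sq[X, φ, P, z])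
    (θ : complexBetti X 2 →ₗ[ℂ] complexBetti X 2)
    (h1 : ∀ y, IsRationalClass y → IsRationalClass (θ y))
    (h2 : ∀ (i j : ℕ) y, IsOfHodgeType 4 X 2 i j y → IsOfHodgeType 4 X 2 i j (θ y))
    (h5 : ∀ y w : complexBetti X 2, k3HilbertForm 2 (φ (θ y)) (φ w) = k3HilbertForm 2 (φ y) (φ (θ w)))
    (hgen : ∀ f : complexBetti X 2 →ₗ[ℂ] complexBetti X 2, (∀ y, IsRationalClass y → IsRationalClass (f y)) →
      (∀ (i j : ℕ) y, IsOfHodgeType 4 X 2 i j y → IsOfHodgeType 4 X 2 i j (f y)) →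
      (∀ e : complexBetti X 2, e ∈ algebraicClasses X 1 → f e = 0) →
      (∀ y : complexBetti X 2, ∀ e : complexBetti X 2, e ∈ algebraicClasses X 1 →
        k3HilbertForm 2 (φ (f y)) (φ e) = 0) →
      ∃ a c : ℚ, ∀ y : complexBetti X 2,
        (∀ e : complexBetti X 2, e ∈ algebraicClasses X 1 → k3HilbertForm 2 (φ y) (φ e) = 0) →
        f y = (a : ℂ) • y + (c : ℂ) • θ y)
    {c : complexBetti X (2 * 2)} (hcrat : IsRationalClass c) (hc22 : IsOfHodgeType 4 X (2 * 2) 2 2 c) :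
    ∃ r : ℚ, c - (r : ℂ) • Kap[φ, θ] ∈ algebraicClasses X 2 := by
  classical
  obtain ⟨F, hF⟩ := exists_classEndomorphism hX hM c
  have hFrat : ∀ y, IsRationalClass y → IsRationalClass (F y) :=
    fun y hy => isRationalClass_classEndomorphism hX hM hF hcrat hy
  have hFh : ∀ (i j : ℕ) y, IsOfHodgeType 4 X 2 i j y → IsOfHodgeType 4 X 2 i j (F y) :=
    fun i j y hy => isOfHodgeType_classEndomorphism hX hM hF hc22 hy
  have hFadj : ∀ y w, k3HilbertForm 2 (φ (F y)) (φ w) = k3HilbertForm 2 (φ y) (φ (F w)) :=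
    classEndomorphism_selfAdjoint hX hM hF
  obtain ⟨πT, hT1, hT2, hT3, hT4, hT5, hT6, hT7⟩ := exists_transcendentalProjector hX hM
  have hN11 : ∀ d ∈ algebraicClasses X 1, IsOfHodgeType 4 X 2 1 1 d := fun d hd =>
    isOfHodgeType_of_mem_algebraicClasses_of_isSmoothProjective hX 1 hd
  -- `θ` preserves `N¹` and `T`
  have hθN : ∀ d ∈ algebraicClasses X 1, θ d ∈ algebraicClasses X 1 :=
    map_mem_algebraicClasses_one_of_rational_hodge hX θ h1 (h2 1 1)
  have hθT : ∀ y : complexBetti X 2, (∀ d ∈ algebraicClasses X 1, k3HilbertForm 2 (φ y) (φ d) = 0) →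
      ∀ d ∈ algebraicClasses X 1, k3HilbertForm 2 (φ (θ y)) (φ d) = 0 :=
    fun y hy d hd => by rw [h5]; exact hy _ (hθN d hd)
  -- Claim A: `πT (F d) = 0` for `d ∈ N¹(X)`
  have hA : ∀ d ∈ algebraicClasses X 1, πT (F d) = 0 := by
    have hspan := supportedClasses_eq_span_isRationalClass hX 2 1
    change algebraicClasses X 1 = Submodule.span ℂ
      {c : complexBetti X 2 | IsRationalClass c ∧ c ∈ algebraicClasses X 1} at hspan
    intro d hd
    rw [hspan] at hd
    have hle : Submodule.span ℂ {c : complexBetti X 2 | IsRationalClass c ∧ c ∈ algebraicClasses X 1} ≤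
        LinearMap.ker (πT ∘ₗ F) := by
      refine Submodule.span_le.2 ?_
      rintro d ⟨hdrat, hdalg⟩
      rw [SetLike.mem_coe, LinearMap.mem_ker, LinearMap.comp_apply]
      have hu_alg : πT (F d) ∈ algebraicClasses X 1 :=
        lefschetzOneOne_rational_holds hX _ (hT5 _ (hFrat _ hdrat)) (hT7 1 1 _ (hFh 1 1 _ (hN11 d hdalg)))
      exact k3HilbertForm_radical_algebraicClasses_one_eq_zero hX hM hu_alg (hT3 (F d))
    simpa only [LinearMap.mem_ker, LinearMap.comp_apply] using hle hd
  -- the hypothesis on `πT F πT`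
  obtain ⟨a, cc, hacc⟩ := hgen (πT ∘ₗ F ∘ₗ πT)
    (fun y hy => by rw [LinearMap.comp_apply, LinearMap.comp_apply]; exact hT5 _ (hFrat _ (hT5 _ hy)))
    (fun i j y hy => by
      rw [LinearMap.comp_apply, LinearMap.comp_apply]; exact hT7 i j _ (hFh i j _ (hT7 i j _ hy)))
    (fun d hd => by rw [LinearMap.comp_apply, LinearMap.comp_apply, hT1 d hd, map_zero, map_zero])
    (fun y d hd => by rw [LinearMap.comp_apply, LinearMap.comp_apply]; exact hT3 _ d hd)
  -- the cubic of `κ_θ`: `F_κ = t + 2θ`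
  obtain ⟨t, hκ⟩ := exists_cup3_kappaClass hM θ
  -- `G := F − (cc t/2) − cc θ`, the endomorphism of `c₁ := c − (cc/2) κ_θ`
  set G : complexBetti X 2 →ₗ[ℂ] complexBetti X 2 :=
    F - ((cc : ℂ) * t / 2) • LinearMap.id - (cc : ℂ) • θ with hGdef
  have hGapp : ∀ y, G y = F y - ((cc : ℂ) * t / 2) • y - (cc : ℂ) • θ y := fun y => by
    simp only [hGdef, LinearMap.sub_apply, LinearMap.smul_apply, LinearMap.id_apply]
  have hqG : ∀ y w, k3HilbertForm 2 (φ (G y)) (φ w) = k3HilbertForm 2 (φ (F y)) (φ w) -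
      (cc : ℂ) * t / 2 * k3HilbertForm 2 (φ y) (φ w) - (cc : ℂ) * k3HilbertForm 2 (φ (θ y)) (φ w) := by
    intro y w
    rw [hGapp, map_sub, map_sub, map_smul, map_smul, sub_eq_add_neg, sub_eq_add_neg, k3HilbertForm_add_left,
      k3HilbertForm_add_left, ← neg_one_smul ℂ (((cc : ℂ) * t / 2) • φ y), ← neg_one_smul ℂ ((cc : ℂ) • φ (θ y)),
      smul_smul, smul_smul, k3HilbertForm_smul_left, k3HilbertForm_smul_left]
    ring
  have hc₁ : ∀ y w, Cup3[c - (((cc / 2 : ℚ) : ℂ)) • Kap[φ, θ], y, w] = (k3HilbertForm 2 (φ (G y)) (φ w)) • P := by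
    intro y w
    simp only [map_sub, map_smul, LinearMap.sub_apply, LinearMap.smul_apply]
    rw [hF, hκ, smul_smul, ← sub_smul, hqG, k3HilbertForm_comm 2 (φ (θ w)) (φ y), ← h5 y w]
    congr 1
    push_cast
    ring
  have hGadj : ∀ y w, k3HilbertForm 2 (φ (G y)) (φ w) = k3HilbertForm 2 (φ y) (φ (G w)) := by
    intro y w
    rw [k3HilbertForm_comm 2 (φ y) (φ (G w)), hqG, hqG, hFadj w y, k3HilbertForm_comm 2 (φ w) (φ (F y)),
      k3HilbertForm_comm 2 (φ w) (φ y), h5 w y, k3HilbertForm_comm 2 (φ w) (φ (θ y))]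
  have hGA : ∀ d ∈ algebraicClasses X 1, πT (G d) = 0 := fun d hd => by
    rw [hGapp, map_sub, map_sub, map_smul, map_smul, hA d hd, hT1 d hd, hT1 _ (hθN d hd), smul_zero, smul_zero,
      sub_zero, sub_zero]
  have hGC : ∀ y : complexBetti X 2, (∀ d ∈ algebraicClasses X 1, k3HilbertForm 2 (φ y) (φ d) = 0) →
      πT (G y) = ((a : ℂ) - (cc : ℂ) * t / 2) • y := by
    intro y hy
    have e1 : πT (F (πT y)) = (a : ℂ) • y + (cc : ℂ) • θ y := by
      have := hacc y hy
      rwa [LinearMap.comp_apply, LinearMap.comp_apply] at this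
    rw [hT2 y hy] at e1
    rw [hGapp, map_sub, map_sub, map_smul, map_smul, e1, hT2 y hy, hT2 _ (hθT y hy), sub_smul]
    abel
  -- the `E = ℚ` engine with the scalar `a' = a − cc t/2`
  set a' : ℂ := (a : ℂ) - (cc : ℂ) * t / 2 with ha'def
  have hβG := k3HilbertForm_blockForm_of_transcendentalScalar φ hGadj hT2 hT3 hT4 hT6 hGA hGC
  set qXform : LinearMap.BilinForm ℂ (complexBetti X 2) :=
    (Matrix.toBilin' (Matrix.map (k3HilbertGram 2) (Int.cast : ℤ → ℂ))).compl₁₂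
      (φ : complexBetti X 2 →ₗ[ℂ] (K3HilbertIndex → ℂ)) (φ : complexBetti X 2 →ₗ[ℂ] (K3HilbertIndex → ℂ))
    with hqXform
  have hqXapp : ∀ y w, qXform y w = k3HilbertForm 2 (φ y) (φ w) := fun y w => by
    rw [hqXform, LinearMap.compl₁₂_apply, qC_apply]; rfl
  set β : complexBetti X 2 →ₗ[ℂ] complexBetti X 2 →ₗ[ℂ] ℂ :=
    qXform.compl₁₂ G LinearMap.id - a' • qXform with hβraw
  have hβdef : ∀ y w, β y w = k3HilbertForm 2 (φ (G y)) (φ w) - a' * k3HilbertForm 2 (φ y) (φ w) := by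
    intro y w
    rw [hβraw, LinearMap.sub_apply, LinearMap.smul_apply, LinearMap.sub_apply, LinearMap.smul_apply,
      LinearMap.compl₁₂_apply, LinearMap.id_apply, hqXapp, hqXapp, smul_eq_mul]
  clear_value β
  have hβsymm : ∀ y w, β y w = β w y := fun y w => by
    rw [hβdef, hβdef, hGadj, k3HilbertForm_comm 2 (φ y) (φ (G w)), k3HilbertForm_comm 2 (φ y) (φ w)]
  have hNT : ∀ n ∈ algebraicClasses X 1, ∀ w, k3HilbertForm 2 (φ n) (φ (πT w)) = 0 := fun n hn w => by
    rw [k3HilbertForm_comm]; exact hT3 w n hn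
  have hqr : ∀ n ∈ algebraicClasses X 1, ∀ y : complexBetti X 2,
      k3HilbertForm 2 (φ n) (φ (y - πT y)) = k3HilbertForm 2 (φ n) (φ y) := by
    intro n hn y
    rw [map_sub, sub_eq_add_neg, k3HilbertForm_add_right, ← neg_one_smul ℂ, k3HilbertForm_smul_right,
      hNT n hn y, mul_zero, add_zero]
  obtain ⟨c', hc'alg, hc'⟩ := exists_algebraicClass_of_symmetricForm hO Voisin2003_cupProduct_algebraicClasses_holds'
    hX hK hM a' β hβsymm (fun y => y - πT y) hT4 hqr
  have hcup3 : ∀ y w : complexBetti X 2, Cup3[c - (((cc / 2 : ℚ) : ℂ)) • Kap[φ, θ], y, w] = Cup3[c', y, w] :=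
    fun y w => by rw [hc₁, hc', hβG, hβdef]
  exact ⟨cc / 2, eq_of_cup3_eq hV hX hK hcup3 ▸ hc'alg⟩

end Summit.HodgeConjecture.HodgeConjecture.Theorems.MarkmanPartnerTransport.PartnerLattice

end
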